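import Literature.AnabelianGeometry.SemiGraphs.ArithBTempOuterModel
import HarnessLib

/-!
# [SemiAnbd] Thm 5.4 (iii) at the outer models — `B^temp(φ)` (functoriality of `⋊^out`): clause (2) ⇐
# and continuity in the discrete-quotient regime

Mochizuki, *Semi-graphs of anabelioids*, Publ. RIMS **42** (2006), §0 p. 5, §5 Def 5.1 (iv) p. 63,
Thm 5.4 (iii) p. 66 ("`φ`, `ψ` are equivalent under the inner action iff `B^temp(ψ)` is an inner conjugate of
`B^temp(φ)`") [cite: MochizukiSemiAnbd2006, Thm 5.4 (iii) p.66].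

PROOF-ONLY sequel (cell abc-iut, layer L3, T54 row «T54iii·btemp-outerModel», piece 4, seat abc-iut-w4-d053
gen 4) of `ArithBTempOuterModel.lean` (`outerSemidirectProductMap` = `B^temp(φ)` at the outer models
`G ⋊^out J → H ⋊^out J′`; its v2 `outerSemidirectProductMap_conj` is clause (2) ⇒):

* `eq_conj_of_outerSemidirectProductMap_eq_conj` — clause (2) ⇐: if the maps induced by `f₁`, `f₂` are
  conjugate by `h = (γ, a′) ∈ H ⋊^out J′` then `f₂ = γ ∘ f₁` (an arithmetic inner twist by the
  `Aut`-component of `h`) and `a′` centralises `e(aug(G ⋊^out J))`;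
* `continuous_outerSemidirectProductMap_of_isOpen_range` — for any group topologies on the two outer
  semi-direct products with `ι_G` an embedding with OPEN image (discrete `Π_A`) and `ι_H ∘ f` continuous,
  `B^temp(φ)` is continuous (the law `hcont` of the T54 umbrella in the finite-monodromy regime of the
  cell's NV designs; for infinite `Π_A` continuity w.r.t. the tempered level topologies is NOT derived).

Nothing here bears on [IUTchIII] Cor. 3.12; typed ≠ proved elsewhere.
-/

namespace Literature.AnabelianGeometry.SemiGraphs

open Literature.AnabelianGeometry.EtaleTheta

section FunctorialityConverse

variable {G : Type*} [Group G] [TopologicalSpace G] [IsTopologicalGroup G]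
  {H : Type*} [Group H] [TopologicalSpace H] [IsTopologicalGroup H]
  {J : Type*} [Group J] {J' : Type*} [Group J']
  (ρG : J →* TopOut G) (ρH : J' →* TopOut H) (e : J →* J')
  {f₁ f₂ : G →* H}
  (hcompat₁ : ∀ p : outerSemidirectProduct ρG, ∃ β' : contMulAut H,
    TopOut.mk H β' = ρH (e (outerSemidirectProductSnd ρG p)) ∧
      ∀ y, (β' : MulAut H) (f₁ y) = f₁ ((p.1.1 : MulAut G) y))
  (hZ₁ : ∀ h : H, (∀ y : G, h * f₁ y * h⁻¹ = f₁ y) → h = 1)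
  (hcompat₂ : ∀ p : outerSemidirectProduct ρG, ∃ β' : contMulAut H,
    TopOut.mk H β' = ρH (e (outerSemidirectProductSnd ρG p)) ∧
      ∀ y, (β' : MulAut H) (f₂ y) = f₂ ((p.1.1 : MulAut G) y))
  (hZ₂ : ∀ h : H, (∀ y : G, h * f₂ y * h⁻¹ = f₂ y) → h = 1)

/-- **Clause (2) of Thm 5.4 (iii) at the outer models, direction ⇐**: if the homomorphisms of outer
semi-direct products induced by `f₁` and `f₂` (same outer actions, same `e`) are conjugate by
`h = (γ, a′) ∈ H ⋊^out J′`, then `f₂ = γ ∘ f₁` — an ARITHMETIC inner twist by the `Aut`-component of `h` —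
and `a′ = aug h` centralises `e(aug(G ⋊^out J))` (so `a′ = 1` and the twist is inner by `H` as soon as
`e` is onto a centre-free `J′`; cf. `outerSemidirectProductMap_conj` for ⇒).
[cite: MochizukiSemiAnbd2006, Thm 5.4 (iii) p.66] -/
theorem eq_conj_of_outerSemidirectProductMap_eq_conj (h : outerSemidirectProduct ρH)
    (hconj : ∀ p, outerSemidirectProductMap ρG ρH e f₂ hcompat₂ hZ₂ p =
      h * outerSemidirectProductMap ρG ρH e f₁ hcompat₁ hZ₁ p * h⁻¹) :
    (∀ y, f₂ y = (h.1.1 : MulAut H) (f₁ y)) ∧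
      ∀ p, outerSemidirectProductSnd ρH h * e (outerSemidirectProductSnd ρG p) *
          (outerSemidirectProductSnd ρH h)⁻¹ = e (outerSemidirectProductSnd ρG p) := by
  refine ⟨fun y => ?_, fun p => ?_⟩
  · apply toOuterSemidirectProduct_injective ρH (center_eq_bot_of_centraliserFree f₁ hZ₁)
    rw [← outerSemidirectProductMap_toOuterSemidirectProduct ρG ρH e f₂ hcompat₂ hZ₂, hconj,
      outerSemidirectProductMap_toOuterSemidirectProduct, conj_toOuterSemidirectProduct]
  · have := congrArg (outerSemidirectProductSnd ρH) (hconj p)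
    rw [map_mul, map_mul, map_inv, outerSemidirectProductSnd_outerSemidirectProductMap,
      outerSemidirectProductSnd_outerSemidirectProductMap] at this
    exact this.symm

end FunctorialityConverse

section FunctorialityContinuity

variable {G : Type*} [Group G] [TopologicalSpace G] [IsTopologicalGroup G]
  {H : Type*} [Group H] [TopologicalSpace H] [IsTopologicalGroup H]
  {J : Type*} [Group J] {J' : Type*} [Group J']
  (ρG : J →* TopOut G) (ρH : J' →* TopOut H) (e : J →* J') (f : G →* H)
  (hcompat : ∀ p : outerSemidirectProduct ρG, ∃ β' : contMulAut H,
    TopOut.mk H β' = ρH (e (outerSemidirectProductSnd ρG p)) ∧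
      ∀ y, (β' : MulAut H) (f y) = f ((p.1.1 : MulAut G) y))
  (hZ : ∀ h : H, (∀ y : G, h * f y * h⁻¹ = f y) → h = 1)

/-- **Continuity in the discrete-quotient regime** (the finite-monodromy / `ρ′ = 1`-type designs of the
cell's NV witnesses): for ANY group topologies on the two outer semi-direct products such that `ι_G` is an
embedding with OPEN image (⟺ `Π_A` discrete when `aug_G` is continuous and open) and `ι_H ∘ f` is
continuous, the induced homomorphism `B^temp(φ)` is continuous (a homomorphism continuous on an open
subgroup is continuous).  For the genuine tempered level topologies with infinite `Π_A` the continuity of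
`B^temp(φ)` is a further input, NOT derived here. [cite: MochizukiSemiAnbd2006, Thm 5.4 (iii) p.66] -/
theorem continuous_outerSemidirectProductMap_of_isOpen_range
    [TopologicalSpace (outerSemidirectProduct ρG)] [IsTopologicalGroup (outerSemidirectProduct ρG)]
    [TopologicalSpace (outerSemidirectProduct ρH)] [IsTopologicalGroup (outerSemidirectProduct ρH)]
    (hemb : Topology.IsEmbedding (toOuterSemidirectProduct ρG))
    (hopen : IsOpen (Set.range (toOuterSemidirectProduct ρG)))
    (hcont : Continuous ((toOuterSemidirectProduct ρH) ∘ f)) :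
    Continuous (outerSemidirectProductMap ρG ρH e f hcompat hZ) := by
  apply continuous_of_continuousAt_one
  have hK : ContinuousOn (outerSemidirectProductMap ρG ρH e f hcompat hZ)
      (Set.range (toOuterSemidirectProduct ρG)) := by
    rw [continuousOn_iff_continuous_restrict]
    have hrestr : (Set.range (toOuterSemidirectProduct ρG)).restrict
          (outerSemidirectProductMap ρG ρH e f hcompat hZ) =
        ((toOuterSemidirectProduct ρH) ∘ f) ∘ hemb.toHomeomorph.symm := by
      funext p
      obtain ⟨x, hx⟩ := hemb.toHomeomorph.surjective p
      subst hx
      rw [Function.comp_apply, Homeomorph.symm_apply_apply, Set.restrict_apply,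
        Topology.IsEmbedding.toHomeomorph_apply_coe, Function.comp_apply]
      exact outerSemidirectProductMap_toOuterSemidirectProduct ρG ρH e f hcompat hZ x
    rw [hrestr]
    exact hcont.comp hemb.toHomeomorph.symm.continuous
  exact hK.continuousAt (hopen.mem_nhds ⟨1, map_one _⟩)

end FunctorialityContinuity

end Literature.AnabelianGeometry.SemiGraphs
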